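import Literature.NumberTheory.EllipticCurves.FrobeniusEndomorphism
import Literature.NumberTheory.EllipticCurves.FrobeniusTateModule
import HarnessLib

/-!
# Point counts of isogenous elliptic curves over a finite field: the prime-degree torsor lemma

Sibling file of `Literature.NumberTheory.EllipticCurves.Isogeny` (D-0014 append protocol; everything
here is proved). The classical fact that two elliptic curves over a finite field `k` which are
isogenous over `k` have the same number of `k`-rational points (Silverman, *The Arithmetic of
Elliptic Curves*, 2nd ed., Exercise 5.4(a), p. 139; it is the easy direction of Tate's isogeny
theorem, *Invent. Math.* 2 (1966), Thm. 1(c), vendored as the named fact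
`Literature.AlgebraicGeometry.Motives.isIsogenous_iff_card_point_eq` of `Literature.AlgebraicGeometry.Motives.FaltingsEC`) is
proved in print through `#E(k) = deg(1 - φ)` (Silverman V.1) or through the `ℓ`-adic
representation, neither of which the tree proves. This file proves, by elementary Galois
cohomology of the finite kernel, the case the tree needs (explicit `2`- and `3`-isogenies between CM
curves, files `TwoIsogenyPointCount`, `ThreeIsogenyKernelXPointCount`):

* `WeierstrassCurve.Isogeny.natCard_point_eq_or_eq_mul_of_surjective`: if `φ : E → E'` is an
  isogeny over the finite field `k` (a term of the prelude structure `WeierstrassCurve.Isogeny`: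
  a `Γ_k`-equivariant homomorphism on `k̄`-points), surjective on `k̄`-points, whose kernel has
  prime order `ℓ`, then `#E(k) = #E'(k)` or `#E(k) = ℓ · #E'(k)`;
* `WeierstrassCurve.natCard_point_eq_of_isogeny_of_isogeny`: if moreover there is such an
  isogeny `ψ : E' → E''` of prime degree with `#E''(k) = #E(k)` (in the applications `E'' ≅ E`
  and `ψ ∘ φ = [ℓ]` up to that isomorphism), then `#E(k) = #E'(k)`.

## The argument (Serre, *Local Fields*, XIII §1 for `H¹` of a finite field; folklore)

Let `σ = σ_q ∈ Γ_k` be the arithmetic Frobenius, acting on `M = E(k̄)` and `M' = E'(k̄)` with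
fixed subgroups `M^σ = E(k)`, `M'^σ = E'(k)` (the tree's
`WeierstrassCurve.smul_eq_self_iff_mem_range_toGeomPoints`, Silverman V.1.1), and let
`f = φ : M → M'`, `σ`-equivariant and onto, with kernel `C` of prime order `ℓ`. The subgroup
`C^σ ≤ C` has order `1` or `ℓ`.
* If `C^σ = C` (the kernel is pointwise rational): `f(M^σ) ≅ M^σ / C` and the connecting map
  `δ : M'^σ → C`, `δ(P') = σP - P` for any `P ∈ f⁻¹(P')` (well defined because `σ` is trivial on
  `C`), is a homomorphism with kernel `f(M^σ)`, so `[M'^σ : f(M^σ)]` divides `ℓ`; hence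
  `#M^σ = ℓ · #f(M^σ) ∈ {ℓ #M'^σ, #M'^σ}` (`IsogenyPointCount.natCard_fixed_eq_or_of_ker_le`).
* If `C^σ = 0`: `h ↦ σh - h` is injective on the finite group `C`, hence onto, and then `f`
  restricts to a *bijection* `M^σ → M'^σ` (injective as `C ∩ M^σ = 0`; onto because for
  `P ∈ f⁻¹(P')` with `σP - P = σh - h` the point `P - h` is fixed) (`IsogenyPointCount.natCard_fixed_eq_of_inf_eq_bot`).
The two-out-of-three corollary is arithmetic: `n ∈ {n', ℓn'}` and `n' ∈ {n, ℓ'n}` force `n = n'`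
as `n = #E(k) ≥ 1`.

The abstract part is stated for endomorphisms `σ, σ'` of abelian groups and an equivariant
surjection `f` (namespace `WeierstrassCurve.IsogenyPointCount`), then specialised to the Frobenius
on geometric points. The file introduces no definitions.

## References

* J. H. Silverman, *The Arithmetic of Elliptic Curves*, 2nd ed., GTM 106 (2009), Thm. V.1.1 and
  its proof (PDF p. 126), Exercise 5.4(a) (p. 139), III.4.8–4.10. [cite: SilvermanAEC2009]
* J. Tate, *Endomorphisms of abelian varieties over finite fields*, Invent. Math. 2 (1966),
  134–144, Thm. 1(c). [cite: Tate1966Endomorphisms]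
* J.-P. Serre, *Local Fields*, GTM 67, XIII §1, Prop. 1–2 (`H¹` of a procyclic group on a finite
  module; Lang's theorem is not needed for a finite kernel).
-/

noncomputable section

open scoped Classical

universe u

namespace WeierstrassCurve

namespace IsogenyPointCount

/-! ## The abstract torsor lemma -/

section Abstract

variable {M M' : Type*} [AddCommGroup M] [AddCommGroup M']
  (σ : M →+ M) (σ' : M' →+ M') (f : M →+ M')

/-- The fixed subgroup `M^σ = {P | σ P = P}` of an endomorphism `σ` is the kernel of `σ - 1`:
membership. (We write `(σ - AddMonoidHom.id M).ker` for `M^σ` throughout.) [folklore] -/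
theorem mem_fixedPts_iff (P : M) : P ∈ (σ - AddMonoidHom.id M).ker ↔ σ P = P := by
  rw [AddMonoidHom.mem_ker, AddMonoidHom.sub_apply, sub_eq_zero, AddMonoidHom.id_apply]

variable {σ σ' f}

/-- An equivariant map sends fixed points to fixed points. [folklore] -/
theorem map_mem_ker_sub_one (hf : ∀ P, f (σ P) = σ' (f P)) {P : M} (hP : P ∈ (σ - AddMonoidHom.id M).ker) :
    f P ∈ (σ' - AddMonoidHom.id M').ker := by
  rw [mem_fixedPts_iff] at hP ⊢
  rw [← hf, hP]

/-- The kernel of the restriction `g : M^σ → M'^{σ'}` of an equivariant `f` is `ker f ∩ M^σ`,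
viewed inside `M^σ`. [folklore] -/
theorem ker_codRestrict_fixed (hf : ∀ P, f (σ P) = σ' (f P)) :
    ((f.comp (σ - AddMonoidHom.id M).ker.subtype).codRestrict (σ' - AddMonoidHom.id M').ker
        (fun P ↦ map_mem_ker_sub_one hf P.2)).ker =
      f.ker.addSubgroupOf (σ - AddMonoidHom.id M).ker := by
  ext P
  rw [AddMonoidHom.mem_ker, AddSubgroup.mem_addSubgroupOf, AddMonoidHom.mem_ker, Subtype.ext_iff]
  rfl

/-- **Case `C^σ = 0`.** If `f` is an equivariant surjection whose (finite) kernel meets the fixed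
subgroup trivially, then `f` restricts to a bijection `M^σ ≃ M'^{σ'}`; in particular the fixed
subgroups have the same cardinality. (For `P' ∈ M'^{σ'}` and `f P = P'`, `σP - P ∈ C = ker f`,
and `h ↦ σh - h` is a bijection of `C`, so some `P - h` is fixed.) Serre, *Local Fields*,
XIII §1. [folklore] -/
theorem natCard_fixed_eq_of_inf_eq_bot (hf : ∀ P, f (σ P) = σ' (f P))
    (hsurj : Function.Surjective f) [Finite f.ker]
    (hC : ∀ k ∈ f.ker, σ k = k → k = 0) :
    Nat.card (σ - AddMonoidHom.id M).ker = Nat.card (σ' - AddMonoidHom.id M').ker := by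
  set g : (σ - AddMonoidHom.id M).ker →+ (σ' - AddMonoidHom.id M').ker :=
    (f.comp (σ - AddMonoidHom.id M).ker.subtype).codRestrict _ fun P ↦ map_mem_ker_sub_one hf P.2
    with hg
  refine Nat.card_congr (Equiv.ofBijective g ⟨?_, ?_⟩)
  · -- injective
    intro P Q hPQ
    have h0 : f (P - Q : M) = 0 := by
      rw [map_sub, sub_eq_zero]
      exact congrArg Subtype.val hPQ
    have hfix : σ (P - Q : M) = (P - Q : M) := by
      rw [map_sub, (mem_fixedPts_iff σ _).mp P.2, (mem_fixedPts_iff σ _).mp Q.2]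
    exact Subtype.ext (sub_eq_zero.mp (hC _ h0 hfix))
  · -- surjective
    intro P'
    obtain ⟨P, hP⟩ := hsurj (P' : M')
    have hk : σ P - P ∈ f.ker := by
      rw [AddMonoidHom.mem_ker, map_sub, hf, hP, sub_eq_zero]
      exact (mem_fixedPts_iff σ' _).mp P'.2
    -- `θ : C → C`, `h ↦ σ h - h`, is injective hence surjective
    have hθmem : ∀ h : f.ker, σ h - h ∈ f.ker := fun h ↦ by
      rw [AddMonoidHom.mem_ker, map_sub, hf, h.2, map_zero, sub_zero]
    set θ : f.ker → f.ker := fun h ↦ ⟨σ h - h, hθmem h⟩ with hθ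
    have hθinj : Function.Injective θ := by
      intro h h' hhh
      have e : σ h - h = σ h' - (h' : M) := congrArg Subtype.val hhh
      have e' : σ (h - h' : M) = (h - h' : M) := by
        rw [map_sub]; exact sub_eq_sub_iff_sub_eq_sub.mp e
      have h0 : (h - h' : M) ∈ f.ker := f.ker.sub_mem h.2 h'.2
      exact Subtype.ext (sub_eq_zero.mp (hC _ h0 e'))
    obtain ⟨h, hh⟩ := (Finite.injective_iff_surjective.mp hθinj) ⟨σ P - P, hk⟩
    have hh' : σ h - h = σ P - (P : M) := congrArg Subtype.val hh
    refine ⟨⟨P - h, (mem_fixedPts_iff σ _).mpr ?_⟩, Subtype.ext ?_⟩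
    · rw [map_sub]; exact sub_eq_sub_iff_sub_eq_sub.mp hh'.symm
    · change f (P - h) = P'
      rw [map_sub, hP, h.2, sub_zero]

/-- **Case `C^σ = C`: the connecting homomorphism.** If `f` is an equivariant surjection whose
kernel `C` is fixed pointwise by `σ`, then `δ(P') = σP - P` (`P ∈ f⁻¹(P')`) is a well-defined
homomorphism `M'^{σ'} → C` whose kernel is `f(M^σ)`; consequently
`#M^σ = ℓ · #f(M^σ)` and `#M'^{σ'} = #f(M^σ) · [M'^{σ'} : f(M^σ)]` with the index dividing
`#C = ℓ`; for `ℓ` prime this gives `#M^σ = #M'^{σ'}` or `#M^σ = ℓ · #M'^{σ'}`. Serre, *Local Fields*,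
XIII §1. [folklore] -/
theorem natCard_fixed_eq_or_of_ker_le (hf : ∀ P, f (σ P) = σ' (f P))
    (hsurj : Function.Surjective f) {ℓ : ℕ} (hℓ : ℓ.Prime) (hcard : Nat.card f.ker = ℓ)
    (hC : f.ker ≤ (σ - AddMonoidHom.id M).ker) :
    Nat.card (σ - AddMonoidHom.id M).ker = Nat.card (σ' - AddMonoidHom.id M').ker ∨
      Nat.card (σ - AddMonoidHom.id M).ker = ℓ * Nat.card (σ' - AddMonoidHom.id M').ker := by
  set g : (σ - AddMonoidHom.id M).ker →+ (σ' - AddMonoidHom.id M').ker :=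
    (f.comp (σ - AddMonoidHom.id M).ker.subtype).codRestrict _ fun P ↦ map_mem_ker_sub_one hf P.2
    with hg
  -- `#M^σ = ℓ · #g(M^σ)`
  have hkerg : Nat.card g.ker = ℓ := by
    rw [hg, ker_codRestrict_fixed hf,
      Nat.card_congr (AddSubgroup.addSubgroupOfEquivOfLe hC).toEquiv, hcard]
  have hF : Nat.card (σ - AddMonoidHom.id M).ker = ℓ * Nat.card g.range := by
    rw [AddSubgroup.card_eq_card_quotient_mul_card_addSubgroup g.ker, hkerg,
      Nat.card_congr (QuotientAddGroup.quotientKerEquivRange g).toEquiv, mul_comm]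
  -- a section of `f` and the connecting map
  set s : M' → M := Function.surjInv hsurj with hs
  have hfs : ∀ P', f (s P') = P' := Function.surjInv_eq hsurj
  have hδmem : ∀ P' : (σ' - AddMonoidHom.id M').ker, σ (s P') - s P' ∈ f.ker := fun P' ↦ by
    rw [AddMonoidHom.mem_ker, map_sub, hf, hfs, sub_eq_zero]
    exact (mem_fixedPts_iff σ' _).mp P'.2
  -- independence of the lift
  have hkey : ∀ (P' : (σ' - AddMonoidHom.id M').ker) (P : M), f P = P' → σ (s P') - s P' = σ P - P := by
    intro P' P hP
    have hmem : s P' - P ∈ f.ker := by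
      rw [AddMonoidHom.mem_ker, map_sub, hfs, hP, sub_self]
    have hfix := (mem_fixedPts_iff σ _).mp (hC hmem)
    rw [map_sub] at hfix
    exact sub_eq_sub_iff_sub_eq_sub.mp hfix
  set δ : (σ' - AddMonoidHom.id M').ker →+ f.ker :=
    { toFun := fun P' ↦ ⟨σ (s P') - s P', hδmem P'⟩
      map_zero' := by
        refine Subtype.ext ?_
        change σ (s (0 : (σ' - AddMonoidHom.id M').ker)) - s (0 : (σ' - AddMonoidHom.id M').ker) = 0
        rw [hkey 0 0 (by rw [map_zero]; rfl), map_zero, sub_zero]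
      map_add' := fun P' Q' ↦ by
        refine Subtype.ext ?_
        change σ (s (P' + Q' : (σ' - AddMonoidHom.id M').ker)) - s (P' + Q' : (σ' - AddMonoidHom.id M').ker) =
          (σ (s P') - s P') + (σ (s Q') - s Q')
        rw [hkey (P' + Q') (s P' + s Q') (by rw [map_add, hfs, hfs]; rfl), map_add]
        abel } with hδ
  -- `ker δ = g(M^σ)`
  have hkerδ : δ.ker = g.range := by
    ext P'
    rw [AddMonoidHom.mem_ker, AddMonoidHom.mem_range]
    constructor
    · intro h0
      have e : σ (s P') - s P' = 0 := congrArg Subtype.val h0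
      refine ⟨⟨s P', (mem_fixedPts_iff σ _).mpr (sub_eq_zero.mp e)⟩, Subtype.ext ?_⟩
      change f (s P') = P'
      exact hfs P'
    · rintro ⟨P, rfl⟩
      refine Subtype.ext ?_
      change σ (s (g P)) - s (g P) = 0
      rw [hkey (g P) P rfl, (mem_fixedPts_iff σ _).mp P.2, sub_self]
  -- `#M'^σ = #g(M^σ) · [ : ]` with the index dividing `ℓ`
  have hF' : Nat.card (σ' - AddMonoidHom.id M').ker = Nat.card δ.range * Nat.card g.range := by
    rw [AddSubgroup.card_eq_card_quotient_mul_card_addSubgroup δ.ker,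
      Nat.card_congr (QuotientAddGroup.quotientKerEquivRange δ).toEquiv, hkerδ]
  have hdvd : Nat.card δ.range ∣ ℓ := hcard ▸ AddSubgroup.card_addSubgroup_dvd_card δ.range
  rcases (Nat.dvd_prime hℓ).mp hdvd with h1 | hl
  · right
    rw [hF, hF', h1, one_mul]
  · left
    rw [hF, hF', hl]

/-- **The prime-degree torsor lemma (abstract form).** For an equivariant surjection `f` with
kernel of prime order `ℓ`: `#M^σ = #M'^{σ'}` or `#M^σ = ℓ · #M'^{σ'}` — according as the fixed
part `C^σ` of the kernel, of order dividing `ℓ`, is all of `C` or trivial. [folklore] -/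
theorem natCard_fixed_eq_or (hf : ∀ P, f (σ P) = σ' (f P)) (hsurj : Function.Surjective f)
    {ℓ : ℕ} (hℓ : ℓ.Prime) (hcard : Nat.card f.ker = ℓ) :
    Nat.card (σ - AddMonoidHom.id M).ker = Nat.card (σ' - AddMonoidHom.id M').ker ∨
      Nat.card (σ - AddMonoidHom.id M).ker = ℓ * Nat.card (σ' - AddMonoidHom.id M').ker := by
  haveI : Finite f.ker := Nat.finite_of_card_ne_zero (hcard ▸ hℓ.ne_zero)
  set C₀ : AddSubgroup f.ker := (σ - AddMonoidHom.id M).ker.addSubgroupOf f.ker with hC₀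
  have hdvd : Nat.card C₀ ∣ ℓ := hcard ▸ AddSubgroup.card_addSubgroup_dvd_card C₀
  rcases (Nat.dvd_prime hℓ).mp hdvd with h1 | hl
  · -- `C^σ = 0`
    left
    refine natCard_fixed_eq_of_inf_eq_bot hf hsurj fun k hk hσk ↦ ?_
    have hmem : (⟨k, hk⟩ : f.ker) ∈ C₀ := by
      rw [hC₀, AddSubgroup.mem_addSubgroupOf]
      exact (mem_fixedPts_iff σ _).mpr hσk
    rw [AddSubgroup.card_eq_one.mp h1] at hmem
    exact congrArg Subtype.val (AddSubgroup.mem_bot.mp hmem)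
  · -- `C^σ = C`
    have htop : C₀ = ⊤ := AddSubgroup.eq_top_of_card_eq C₀ (hl.trans hcard.symm)
    refine natCard_fixed_eq_or_of_ker_le hf hsurj hℓ hcard fun k hk ↦ ?_
    have : (⟨k, hk⟩ : f.ker) ∈ C₀ := htop ▸ AddSubgroup.mem_top _
    rw [hC₀, AddSubgroup.mem_addSubgroupOf] at this
    exact this

end Abstract

end IsogenyPointCount

/-! ## Frobenius-fixed geometric points -/

section Frobenius

open _root_.WeierstrassCurve.IsogenyPointCount

variable {K : Type u} [Field K] [Finite K] (W : WeierstrassCurve K)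

/-- For the arithmetic Frobenius `σ_q`, the fixed subgroup `E(k̄)^{σ_q}` is in bijection with
`E(k)` (the tree's `smul_eq_self_iff_mem_range_toGeomPoints`, Silverman V.1.1, and injectivity of
`E(k) → E(k̄)`), so `#E(k̄)^{σ_q} = #E(k)`. [cite: SilvermanAEC2009, proof of Thm. V.1.1] -/
theorem natCard_ker_smul_sub_id {σ : Field.absoluteGaloisGroup K}
    (hσ : ∀ x : AlgebraicClosure K, σ • x = x ^ Nat.card K) :
    Nat.card (DistribSMul.toAddMonoidHom W.geomPoints σ - AddMonoidHom.id W.geomPoints).ker = Nat.card W.toAffine.Point := by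
  symm
  refine Nat.card_congr (Equiv.ofBijective
    (fun P ↦ ⟨W.toGeomPoints P, (mem_fixedPts_iff _ _).mpr (W.smul_toGeomPoints σ P)⟩)
    ⟨fun P Q h ↦ W.toGeomPoints_injective (congrArg Subtype.val h), fun Q ↦ ?_⟩)
  obtain ⟨P, hP⟩ := (smul_eq_self_iff_mem_range_toGeomPoints hσ (Q : W.geomPoints)).mp
    ((mem_fixedPts_iff _ _).mp Q.2)
  exact ⟨P, Subtype.ext hP⟩

end Frobenius

/-! ## The torsor lemma for isogenies over a finite field -/

section Isogeny

open _root_.WeierstrassCurve.IsogenyPointCount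

variable {K : Type u} [Field K] [Finite K] {W W' W'' : WeierstrassCurve K}

/-- **Prime-degree torsor lemma.** Let `φ : E → E'` be an isogeny of elliptic curves over a
finite field `k` (a `Γ_k`-equivariant homomorphism on `k̄`-points, the prelude's
`WeierstrassCurve.Isogeny`) which is onto on `k̄`-points and whose kernel has prime order `ℓ`.
Then `#E(k) = #E'(k)` or `#E(k) = ℓ · #E'(k)`. (Isogenous curves over a finite field have equally
many points — Silverman, *AEC*, Exercise 5.4(a); Tate 1966, Thm. 1(c) — so the second case never
occurs, but excluding it needs `#E = deg(1 - Frob)`; the tree uses instead the two-out-of-three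
corollary below.) Proof: the abstract torsor lemma `natCard_fixed_eq_or` for the arithmetic
Frobenius `σ_q`, whose fixed points on `E(k̄)`, `E'(k̄)` are `E(k)`, `E'(k)` (Silverman V.1.1).
[cite: SilvermanAEC2009, Exercise 5.4(a) (p. 139) and proof of Thm. V.1.1 (PDF p. 126)] -/
theorem Isogeny.natCard_point_eq_or_eq_mul_of_surjective (φ : Isogeny W W')
    (hsurj : Function.Surjective φ) {ℓ : ℕ} (hℓ : ℓ.Prime)
    (hker : Nat.card φ.toAddMonoidHom.ker = ℓ) :
    Nat.card W.toAffine.Point = Nat.card W'.toAffine.Point ∨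
      Nat.card W.toAffine.Point = ℓ * Nat.card W'.toAffine.Point := by
  obtain ⟨σ, hσ⟩ := exists_frobenius_absoluteGaloisGroup K
  rw [← W.natCard_ker_smul_sub_id hσ, ← W'.natCard_ker_smul_sub_id hσ]
  exact IsogenyPointCount.natCard_fixed_eq_or (σ := DistribSMul.toAddMonoidHom W.geomPoints σ)
    (σ' := DistribSMul.toAddMonoidHom W'.geomPoints σ) (f := φ.toAddMonoidHom)
    (fun P ↦ φ.equivariant σ P) hsurj hℓ hker

/-- Over a finite field `E(k)` is finite and nonempty, so `#E(k) ≥ 1`. [folklore] -/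
theorem natCard_point_ne_zero (W : WeierstrassCurve K) : Nat.card W.toAffine.Point ≠ 0 := by
  haveI := W.finite_point
  exact Nat.card_pos.ne'

/-- **Two out of three.** Let `φ : E → E'` and `ψ : E' → E''` be isogenies over the finite field
`k`, onto on `k̄`-points, with kernels of prime orders `ℓ`, `ℓ'`, and suppose
`#E''(k) = #E(k)` (e.g. `E'' ≅ E` over `k`). Then `#E(k) = #E'(k)`: by the torsor lemma
`n ∈ {n', ℓ n'}` and `n' ∈ {n, ℓ' n}`, and `n = ℓ n' = ℓ ℓ' n` or `n = ℓ n` is impossible for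
`n = #E(k) ≥ 1`. This is how the tree obtains Silverman's Exercise 5.4(a) for an explicit
isogeny together with an explicit isogeny "of dual type".
[cite: SilvermanAEC2009, Exercise 5.4(a) (p. 139)] -/
theorem natCard_point_eq_of_isogeny_of_isogeny (φ : Isogeny W W') (ψ : Isogeny W' W'')
    (hφ : Function.Surjective φ) (hψ : Function.Surjective ψ) {ℓ ℓ' : ℕ} (hℓ : ℓ.Prime)
    (hℓ' : ℓ'.Prime) (hkerφ : Nat.card φ.toAddMonoidHom.ker = ℓ)
    (hkerψ : Nat.card ψ.toAddMonoidHom.ker = ℓ')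
    (h : Nat.card W''.toAffine.Point = Nat.card W.toAffine.Point) :
    Nat.card W.toAffine.Point = Nat.card W'.toAffine.Point := by
  have hn := natCard_point_ne_zero W
  rcases φ.natCard_point_eq_or_eq_mul_of_surjective hφ hℓ hkerφ with h₁ | h₁
  · exact h₁
  rcases ψ.natCard_point_eq_or_eq_mul_of_surjective hψ hℓ' hkerψ with h₂ | h₂
  · -- `n = ℓ n'`, `n' = n''= n`
    rw [h] at h₂
    rw [h₂] at h₁
    have : Nat.card W.toAffine.Point * (ℓ - 1) = 0 := by
      have hl := hℓ.one_lt.le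
      zify [hl] at h₁ ⊢
      linear_combination -h₁
    rcases Nat.mul_eq_zero.mp this with h0 | h0
    · exact absurd h0 hn
    · exact absurd h0 (Nat.sub_ne_zero_of_lt hℓ.one_lt)
  · -- `n = ℓ n'`, `n' = ℓ' n`
    rw [h] at h₂
    rw [h₂] at h₁
    have : Nat.card W.toAffine.Point * (ℓ * ℓ' - 1) = 0 := by
      have hl : 1 ≤ ℓ * ℓ' := Nat.one_le_iff_ne_zero.mpr (mul_ne_zero hℓ.ne_zero hℓ'.ne_zero)
      zify [hl] at h₁ ⊢
      linear_combination -h₁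
    rcases Nat.mul_eq_zero.mp this with h0 | h0
    · exact absurd h0 hn
    · have : 1 < ℓ * ℓ' := lt_of_lt_of_le hℓ.one_lt (Nat.le_mul_of_pos_right _ hℓ'.pos)
      exact absurd h0 (Nat.sub_ne_zero_of_lt this)

end Isogeny

end WeierstrassCurve
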